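import Summits.ABC.StewartYu.PadicG3ParVM
import HarnessLib

/-!
# The `p`-adic Gen-3 parameter record v2 (corrected family `…V`) — part VN: the m = 0 headline in the route holder's form

Support file (plain theorems; no named facts). Continues `PadicG3ParVM`. The route holder's requested shape
(plan g9 2026-08-27T04:58:45Z / 04:59:21Z): a FACTOR-2 stronger left side and the right side `2^{110 n}·p·Ω·Wp`
in the v1 currency `PadicG3Par.Wp = W + log p + log(2 Amax)` (= `Wplus`):
**`headline_V' : 2·(8·2ⁿ·Zp + CondFloorV n) ≤ 2^{110·n}·p·Ω·Wp`** under the m = 0 context — from `headline_V`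
(`≤ 2^{44}(16 C_b)ⁿ(p/log p)ΩW⁺`) with `log p ≥ 1`, `16 C_b ≤ 2^{11}`, `2^{45+11n} ≤ 2^{110n}`.

## References
* [Yu2013] K. Yu, Acta Math. 211 (2013) — Theorem 1 (shape of the main term).
-/

noncomputable section

open Finset Real

namespace Summit.ABC.StewartYu

namespace PadicG3Par

variable {n : ℕ} (P : PadicG3Par n)

/-- `Wplus = Wp`. [folklore] -/
theorem Wplus_eq_Wp : P.Wplus = P.Wp := rfl

/-- `16 · C_b ≤ 2^{11}` (`C_b = 32 e ≤ 96`). [folklore] -/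
theorem sixteen_Cb_le : 16 * Cb ≤ (2 : ℝ) ^ 11 := by
  unfold Cb cM; have := Real.exp_one_lt_d9; push_cast; nlinarith

/-- **`headline_V'` (route holder's form): `2·(8·2ⁿ·Zp + CondFloorV n) ≤ 2^{110 n}·p·Ω·Wp`** under the m = 0 context.
[cite: Yu2013, Theorem 1 (shape)] -/
theorem headline_V' (hm : P.m = 0) (hθ : P.θ₀ = 1 / 2) (hn2 : 2 ≤ n) (hA1 : ∀ j, 1 ≤ P.A j)
    (hAmaxΩ : P.Amax ≤ 2 ^ n * P.Ω) (hNq : P.Nq = P.K) (hK₀ : (P.K₀ : ℝ) = P.p - 1) :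
    2 * (8 * 2 ^ n * P.Zp + P.CondFloorV n) ≤ (2 : ℝ) ^ (110 * n) * P.p * P.Ω * P.Wp := by
  have h := P.headline_V hm hθ hn2 hA1 hAmaxΩ hNq hK₀
  rw [P.Wplus_eq_Wp] at h
  have hl16 := P.sixteen_mul_le_log_p hm hθ
  have hn1 : (2 : ℝ) ≤ n := by exact_mod_cast hn2
  have hl1 : (1 : ℝ) ≤ Real.log P.p := by nlinarith
  have hl := P.log_p_pos
  have hp : (2 : ℝ) ≤ P.p := P.two_le_p
  have hΩ := P.one_le_Ω hA1
  obtain ⟨hlW, _, _, _⟩ := P.Wplus_facts hA1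
  rw [P.Wplus_eq_Wp] at hlW
  have hWp0 : 0 ≤ P.Wp := by linarith
  -- `p/log p ≤ p`
  have hpl : (P.p : ℝ) / Real.log P.p ≤ P.p := div_le_self (by linarith) hl1
  have hB : (P.p : ℝ) / Real.log P.p * P.Ω * P.Wp ≤ P.p * P.Ω * P.Wp := by
    have h0 : 0 ≤ P.Ω * P.Wp := by positivity
    nlinarith
  -- `2 · 2^44 · (16 C_b)ⁿ ≤ 2^{110 n}`
  have hC : 2 * ((2 : ℝ) ^ 44 * (16 * Cb) ^ n) ≤ 2 ^ (110 * n) := by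
    have h1 : (16 * Cb) ^ n ≤ ((2 : ℝ) ^ 11) ^ n := pow_le_pow_left₀ (by have := Cb_pos; positivity) sixteen_Cb_le n
    have h2 : 2 * ((2 : ℝ) ^ 44 * ((2 : ℝ) ^ 11) ^ n) = 2 ^ (45 + 11 * n) := by
      rw [← pow_mul, pow_add, pow_succ]; ring
    have h3 : (2 : ℝ) ^ (45 + 11 * n) ≤ 2 ^ (110 * n) := pow_le_pow_right₀ (by norm_num) (by omega)
    nlinarith [pow_pos (two_pos (α := ℝ)) 44]
  have hB0 : 0 ≤ (P.p : ℝ) / Real.log P.p * P.Ω * P.Wp := by positivity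
  have hP0 : 0 ≤ (P.p : ℝ) * P.Ω * P.Wp := by positivity
  calc 2 * (8 * 2 ^ n * P.Zp + P.CondFloorV n) ≤ 2 * (2 ^ 44 * (16 * Cb) ^ n * (P.p / Real.log P.p) * P.Ω * P.Wp) := by
        linarith
    _ = 2 * (2 ^ 44 * (16 * Cb) ^ n) * (P.p / Real.log P.p * P.Ω * P.Wp) := by ring
    _ ≤ 2 * (2 ^ 44 * (16 * Cb) ^ n) * (P.p * P.Ω * P.Wp) :=
        mul_le_mul_of_nonneg_left hB (by have := Cb_pos; positivity)
    _ ≤ 2 ^ (110 * n) * (P.p * P.Ω * P.Wp) := mul_le_mul_of_nonneg_right hC hP0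
    _ = 2 ^ (110 * n) * P.p * P.Ω * P.Wp := by ring

/-- **`headline_V100`** — the same with the cell constant `cY07 = 2^{100}` (plan g9 2026-08-27T05:05:21Z):
`2·(8·2ⁿ·Zp + CondFloorV n) ≤ 2^{100 n}·p·Ω·Wp` under the m = 0 context. [cite: Yu2013, Theorem 1 (shape)] -/
theorem headline_V100 (hm : P.m = 0) (hθ : P.θ₀ = 1 / 2) (hn2 : 2 ≤ n) (hA1 : ∀ j, 1 ≤ P.A j)
    (hAmaxΩ : P.Amax ≤ 2 ^ n * P.Ω) (hNq : P.Nq = P.K) (hK₀ : (P.K₀ : ℝ) = P.p - 1) :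
    2 * (8 * 2 ^ n * P.Zp + P.CondFloorV n) ≤ (2 : ℝ) ^ (100 * n) * P.p * P.Ω * P.Wp := by
  have h := P.headline_V hm hθ hn2 hA1 hAmaxΩ hNq hK₀
  rw [P.Wplus_eq_Wp] at h
  have hl16 := P.sixteen_mul_le_log_p hm hθ
  have hn1 : (2 : ℝ) ≤ n := by exact_mod_cast hn2
  have hl1 : (1 : ℝ) ≤ Real.log P.p := by nlinarith
  have hl := P.log_p_pos
  have hp : (2 : ℝ) ≤ P.p := P.two_le_p
  have hΩ := P.one_le_Ω hA1
  obtain ⟨hlW, _, _, _⟩ := P.Wplus_facts hA1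
  rw [P.Wplus_eq_Wp] at hlW
  have hWp0 : 0 ≤ P.Wp := by linarith
  have hpl : (P.p : ℝ) / Real.log P.p ≤ P.p := div_le_self (by linarith) hl1
  have hB : (P.p : ℝ) / Real.log P.p * P.Ω * P.Wp ≤ P.p * P.Ω * P.Wp := by
    have h0 : 0 ≤ P.Ω * P.Wp := by positivity
    nlinarith
  have hC : 2 * ((2 : ℝ) ^ 44 * (16 * Cb) ^ n) ≤ 2 ^ (100 * n) := by
    have h1 : (16 * Cb) ^ n ≤ ((2 : ℝ) ^ 11) ^ n := pow_le_pow_left₀ (by have := Cb_pos; positivity) sixteen_Cb_le n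
    have h2 : 2 * ((2 : ℝ) ^ 44 * ((2 : ℝ) ^ 11) ^ n) = 2 ^ (45 + 11 * n) := by
      rw [← pow_mul, pow_add, pow_succ]; ring
    have h3 : (2 : ℝ) ^ (45 + 11 * n) ≤ 2 ^ (100 * n) := pow_le_pow_right₀ (by norm_num) (by omega)
    nlinarith [pow_pos (two_pos (α := ℝ)) 44]
  have hP0 : 0 ≤ (P.p : ℝ) * P.Ω * P.Wp := by positivity
  calc 2 * (8 * 2 ^ n * P.Zp + P.CondFloorV n) ≤ 2 * (2 ^ 44 * (16 * Cb) ^ n * (P.p / Real.log P.p) * P.Ω * P.Wp) := by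
        linarith
    _ = 2 * (2 ^ 44 * (16 * Cb) ^ n) * (P.p / Real.log P.p * P.Ω * P.Wp) := by ring
    _ ≤ 2 * (2 ^ 44 * (16 * Cb) ^ n) * (P.p * P.Ω * P.Wp) :=
        mul_le_mul_of_nonneg_left hB (by have := Cb_pos; positivity)
    _ ≤ 2 ^ (100 * n) * (P.p * P.Ω * P.Wp) := mul_le_mul_of_nonneg_right hC hP0
    _ = 2 ^ (100 * n) * P.p * P.Ω * P.Wp := by ring

/-- `headline_V100` in the CTX literal shape `((2:ℝ)^100)^n · p · Ω · Wp`. [cite: Yu2013, Theorem 1 (shape)] -/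
theorem headline_V100_lit (hm : P.m = 0) (hθ : P.θ₀ = 1 / 2) (hn2 : 2 ≤ n) (hA1 : ∀ j, 1 ≤ P.A j)
    (hAmaxΩ : P.Amax ≤ 2 ^ n * P.Ω) (hNq : P.Nq = P.K) (hK₀ : (P.K₀ : ℝ) = P.p - 1) :
    2 * (8 * 2 ^ n * P.Zp + P.CondFloorV n) ≤ ((2 : ℝ) ^ 100) ^ n * P.p * P.Ω * P.Wp := by
  rw [← pow_mul]; exact P.headline_V100 hm hθ hn2 hA1 hAmaxΩ hNq hK₀

/-- `headline_V100` in the frame's `(p/log p)` currency: `2·(8·2ⁿ·Zp + CondFloorV n) ≤ 2^{100n}·(p/log p)·Ω·Wp`.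
[cite: Yu2013, Theorem 1 (shape)] -/
theorem headline_V100_div_log (hm : P.m = 0) (hθ : P.θ₀ = 1 / 2) (hn2 : 2 ≤ n) (hA1 : ∀ j, 1 ≤ P.A j)
    (hAmaxΩ : P.Amax ≤ 2 ^ n * P.Ω) (hNq : P.Nq = P.K) (hK₀ : (P.K₀ : ℝ) = P.p - 1) :
    2 * (8 * 2 ^ n * P.Zp + P.CondFloorV n) ≤ (2 : ℝ) ^ (100 * n) * (P.p / Real.log P.p) * P.Ω * P.Wp := by
  have h := P.headline_V hm hθ hn2 hA1 hAmaxΩ hNq hK₀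
  rw [P.Wplus_eq_Wp] at h
  have hl := P.log_p_pos
  have hp : (2 : ℝ) ≤ P.p := P.two_le_p
  have hΩ := P.one_le_Ω hA1
  obtain ⟨hlW, _, _, _⟩ := P.Wplus_facts hA1
  rw [P.Wplus_eq_Wp] at hlW
  have hWp0 : 0 ≤ P.Wp := by linarith
  have hC : 2 * ((2 : ℝ) ^ 44 * (16 * Cb) ^ n) ≤ 2 ^ (100 * n) := by
    have h1 : (16 * Cb) ^ n ≤ ((2 : ℝ) ^ 11) ^ n := pow_le_pow_left₀ (by have := Cb_pos; positivity) sixteen_Cb_le n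
    have h2 : 2 * ((2 : ℝ) ^ 44 * ((2 : ℝ) ^ 11) ^ n) = 2 ^ (45 + 11 * n) := by
      rw [← pow_mul, pow_add, pow_succ]; ring
    have h3 : (2 : ℝ) ^ (45 + 11 * n) ≤ 2 ^ (100 * n) := pow_le_pow_right₀ (by norm_num) (by omega)
    nlinarith [pow_pos (two_pos (α := ℝ)) 44]
  have hB0 : 0 ≤ (P.p : ℝ) / Real.log P.p * P.Ω * P.Wp := by positivity
  calc 2 * (8 * 2 ^ n * P.Zp + P.CondFloorV n) ≤ 2 * (2 ^ 44 * (16 * Cb) ^ n * (P.p / Real.log P.p) * P.Ω * P.Wp) := by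
        linarith
    _ = 2 * (2 ^ 44 * (16 * Cb) ^ n) * (P.p / Real.log P.p * P.Ω * P.Wp) := by ring
    _ ≤ 2 ^ (100 * n) * (P.p / Real.log P.p * P.Ω * P.Wp) := mul_le_mul_of_nonneg_right hC hB0
    _ = 2 ^ (100 * n) * (P.p / Real.log P.p) * P.Ω * P.Wp := by ring

/-- … and in the CTX literal `(p/log p)` shape `((2:ℝ)^100)^n · (p/log p) · Ω · Wp`. [cite: Yu2013, Theorem 1 (shape)] -/
theorem headline_V100_div_log_lit (hm : P.m = 0) (hθ : P.θ₀ = 1 / 2) (hn2 : 2 ≤ n) (hA1 : ∀ j, 1 ≤ P.A j)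
    (hAmaxΩ : P.Amax ≤ 2 ^ n * P.Ω) (hNq : P.Nq = P.K) (hK₀ : (P.K₀ : ℝ) = P.p - 1) :
    2 * (8 * 2 ^ n * P.Zp + P.CondFloorV n) ≤ ((2 : ℝ) ^ 100) ^ n * (P.p / Real.log P.p) * P.Ω * P.Wp := by
  rw [← pow_mul]; exact P.headline_V100_div_log hm hθ hn2 hA1 hAmaxΩ hNq hK₀

end PadicG3Par

end Summit.ABC.StewartYu
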